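import Summits.ResolutionOfSingularities.ResolutionOfSingularities.Theorems.PurelyInseparableDim4ResConeLevelTwoAbsorption
import HarnessLib
import HarnessLib.Audit.Tags

/-!
# Purely inseparable four-folds — LEVEL-2 THIRD-LETTER STEP: after a both-kept step in a third chart letter
# the sheared level-2 cone is `x_j`-LINEAR modulo `(x_a x_{b′})` (cell `res-dim4-pi`, K2(p) lane, slice B
# brick K21)

[OURS · counted 0 · cell `res-dim4-pi` · K2(p) lane holder res-dim4-p-12 g3's brick by signature (bus
2026-08-29 00:28Z, K7-prep, SLICE-B-ARCH v1.4 §9), reshaped as announced 00:33Z · seat res-dim4-p-1 g3 · over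
res-dim4-p-9 g3's K17 `…ResConeLevelTwoTransport` and K20 `…ResConeLevelTwoAbsorption`.]  Nothing here proves
K2(p) (the light regime of slice B stays OPEN), `NoIsolatedTrap p p` or resolution of singularities in
dimension ≥ 4 / characteristic `p`.  AI kernel work, weaker than expert review.

K20 treats the SELF-chart step (`j = a`): the sheared level-2 cone `shear a b (in_{d−1} S)` is `x_a`-free.  Here the
step is taken in a THIRD letter `j ∉ {a, b′}` with both ledger letters kept; K17 (`levelTwo_transport`) then
gives the level-2 relation with ONE extra factor `x_j`:
`S′ ≡ x_j · U · chartTransform (d−1) univ j (shear j b S) (mod x_a x_{b′})`, and `ord S′ ≥ d − 1` (K16 at the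
child).  Consequently the homogeneous parts of `U · T_{d−1}(shear S)` of degree `< d − 2` lie in `(x_a x_{b′})`
(`coeff_mul_X` peels the `x_j`), hence (K20's triangular induction `coeff_eq_zero_of_unit_mul`) so do those of
`T_{d−1}(shear S)`; and a cone monomial `x^e` of `shear j b (in_{d−1} S)` with `e_j = t ≥ 2` is carried by the
injective chart law to a monomial of degree `d − 1 − t ≤ d − 3` with the SAME `a`/`b′`-exponents, so it must be
divisible by `x_a x_{b′}`:

* **`levelTwo_shear_cone_thirdLetter`** — `∀ e ∈ supp (shear j b (in_{d−1} S)), 2 ≤ e j → x_a x_{b′} ∣ x^e`;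
* **`levelTwo_shear_cone_thirdLetter_split`** — `shear j b (in_{d−1} S) ≡ P (mod x_a x_{b′})` with `P`
  homogeneous of degree `d − 1` and of `x_j`-degree `≤ 1` («the second polar of the level-2 cone along the
  direction vanishes modulo the two kept letters» — ONE unit of slack compared with K20).

Honest note (bus 00:33Z): the literal «`e j ≤ 1`» does not follow without reducing the cone modulo
`(x_a x_{b′})` — nothing in the ledger kills a cone monomial `x_j²·x_a x_{b′}·(…)`.  Pure chart algebra: no
`b j = 0`, no `b a = b b′ = 0`, no step data are used.
[cite: CossartJannsenSaito2020, Thm. 3.10(4), Thm. 9.3] [cite: HauserPerlega2019PRIMS, §2 (the blowup in the x₁-chart)]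
bears_on: LADDER-RESOLUTION:D157-DOOR2 (res-dim4-pi · K2(p) · slice B · K21).  Supports
stmt-ResolutionOfSingularities-16155 (helper).
-/

set_option linter.dupNamespace false -- mandated namespace of this single-conjunct summit

noncomputable section

namespace Summit.ResolutionOfSingularities.ResolutionOfSingularities.Theorems.PIDim4

namespace ResCone

open MvPolynomial Finset
open Literature.AlgebraicGeometry.Resolution
open Literature.AlgebraicGeometry.Resolution.CentreBlowup
open Literature.AlgebraicGeometry.Resolution.Hauser2010
open Literature.AlgebraicGeometry.Resolution.HauserPerlega2019

variable {K : Type} [Field K]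

/-- Peeling a third letter: `x_j · Q ∈`-type coefficients — `coeff_{e + e_j} (x_j · Q) = coeff_e Q`, and
divisibility of `x^{e + e_j}` by `x_a x_{b′}` is that of `x^e` when `j ∉ {a, b′}`. [folklore] -/
theorem single_add_single_le_add_single_iff {j a b' : Fin 4} (hja : j ≠ a) (hjb : j ≠ b')
    (e : Fin 4 →₀ ℕ) :
    Finsupp.single a 1 + Finsupp.single b' 1 ≤ e + Finsupp.single j 1 ↔
      Finsupp.single a 1 + Finsupp.single b' 1 ≤ e := by
  simp only [Finsupp.le_def, Finsupp.add_apply, Finsupp.single_apply]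
  constructor
  · intro h i
    have hi := h i
    by_cases hij : j = i
    · subst hij
      rw [if_neg hja.symm, if_neg hjb.symm]
      exact Nat.zero_le _
    · rw [if_neg hij, add_zero] at hi
      exact hi
  · intro h i
    exact (h i).trans (Nat.le_add_right _ _)

/-- **(K21) THE SHEARED LEVEL-2 CONE IS `x_j`-LINEAR MODULO `(x_a x_{b′})` after a both-kept step in a
third chart letter `j ∉ {a, b′}`**: if `U(0) ≠ 0`, `ord S ≥ d − 1`,
`S′ ≡ x_j · U · chartTransform (d−1) univ j (shear j b S) (mod x_a x_{b′})` (K17) and `ord S′ ≥ d − 1` (K16 at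
the child), then every monomial `x^e` of `shear j b (in_{d−1} S)` with `e_j ≥ 2` is divisible by `x_a x_{b′}`.
[OURS] [cite: CossartJannsenSaito2020, Thm. 3.10(4), Thm. 9.3] -/
theorem levelTwo_shear_cone_thirdLetter [DecidableEq K] {j a b' : Fin 4} (hja : j ≠ a) (hjb : j ≠ b')
    (b : Fin 4 → K) {S S' U : MvPolynomial (Fin 4) K} {d : ℕ}
    (hU : MvPolynomial.eval (0 : Fin 4 → K) U ≠ 0) (hS : ∀ m ∈ S.support, d - 1 ≤ m.degree)
    (hrel : S' - X j * (U * chartTransform (d - 1) Finset.univ j (shear j b S)) ∈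
      Ideal.span {(X a * X b' : MvPolynomial (Fin 4) K)})
    (hord' : ∀ m ∈ S'.support, d - 1 ≤ m.degree) :
    ∀ e ∈ (shear j b (homogeneousComponent (d - 1) S)).support,
      2 ≤ e j → Finsupp.single a 1 + Finsupp.single b' 1 ≤ e := by
  set W := chartTransform (d - 1) Finset.univ j (shear j b S) with hW
  -- (1) below degree `d − 2`, `U·W ≡ 0 (mod x_a x_{b′})`: peel the `x_j` from `S′ ≡ x_j·U·W`
  have h1 : ∀ e : Fin 4 →₀ ℕ, e.degree < d - 2 → ¬ Finsupp.single a 1 + Finsupp.single b' 1 ≤ e →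
      coeff e (U * W) = 0 := by
    intro e he hne
    have hS'0 : coeff (e + Finsupp.single j 1) S' = 0 := by
      by_contra h
      have hdeg := hord' _ (MvPolynomial.mem_support_iff.mpr h)
      rw [map_add, Finsupp.degree_single] at hdeg
      omega
    have h2 := coeff_eq_zero_of_mem_span_X_mul_X hrel (e := e + Finsupp.single j 1)
      (by rw [single_add_single_le_add_single_iff hja hjb]; exact hne)
    rw [coeff_sub, hS'0, zero_sub, neg_eq_zero, mul_comm (X j), coeff_mul_X] at h2
    exact h2
  -- (2) triangular induction: the same for `W`
  have h2 := coeff_eq_zero_of_unit_mul hU h1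
  -- (3) a cone monomial with `e_j ≥ 2` prime to `x_a x_{b′}` contradicts (2)
  intro e he hej
  by_contra hne
  have hhom := isHomogeneous_shear j b (homogeneousComponent_isHomogeneous (d - 1) S)
    (MvPolynomial.mem_support_iff.mp he)
  rw [weight_one_eq_degree] at hhom
  have hcoef : coeff e (shear j b S) ≠ 0 := by
    rw [coeff_shear_eq_coeff_shear_homogeneousComponent j b S hhom]
    exact MvPolynomial.mem_support_iff.mp he
  have hq : ((d - 1 : ℕ) : ℕ∞) ≤ ordAlong Finset.univ (shear j b S) :=
    le_ordAlong_of_forall fun m hm => by rw [degIn_univ]; exact forall_le_degree_shear j b hS m hm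
  have hW' : coeff (chartExponent (d - 1) Finset.univ j e) W = coeff e (shear j b S) :=
    coeff_chartTransform_chartExponent' hq hhom.ge
  have hdeg : (chartExponent (d - 1) Finset.univ j e).degree + e j = d - 1 := by
    rw [← hhom]; exact degree_chartExponent_self_degree j e
  have hzero := h2 (chartExponent (d - 1) Finset.univ j e) (by omega) (fun hle => hne (by
    rw [Finsupp.le_def] at hle ⊢
    intro i
    have hi := hle i
    by_cases hij : i = j
    · rw [hij, Finsupp.add_apply, Finsupp.single_apply, Finsupp.single_apply, if_neg hja.symm,
        if_neg hjb.symm]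
      exact Nat.zero_le _
    · rwa [chartExponent_apply_of_ne _ _ hij] at hi))
  exact hcoef (hW' ▸ hzero)

/-- **(K21, split form) `shear j b (in_{d−1} S) ≡ P (mod x_a x_{b′})` with `P` homogeneous of degree `d − 1` and
of `x_j`-degree `≤ 1`** — the second polar of the level-2 cone along the step direction vanishes modulo the two
kept letters (ONE unit of slack against K20's self-chart case). [OURS]
[cite: CossartJannsenSaito2020, Thm. 3.10(4), Thm. 9.3] -/
theorem levelTwo_shear_cone_thirdLetter_split [DecidableEq K] {j a b' : Fin 4} (hja : j ≠ a) (hjb : j ≠ b')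
    (b : Fin 4 → K) {S S' U : MvPolynomial (Fin 4) K} {d : ℕ}
    (hU : MvPolynomial.eval (0 : Fin 4 → K) U ≠ 0) (hS : ∀ m ∈ S.support, d - 1 ≤ m.degree)
    (hrel : S' - X j * (U * chartTransform (d - 1) Finset.univ j (shear j b S)) ∈
      Ideal.span {(X a * X b' : MvPolynomial (Fin 4) K)})
    (hord' : ∀ m ∈ S'.support, d - 1 ≤ m.degree) :
    ∃ P : MvPolynomial (Fin 4) K, (∀ e ∈ P.support, e j ≤ 1) ∧ P.IsHomogeneous (d - 1) ∧
      shear j b (homogeneousComponent (d - 1) S) - P ∈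
        Ideal.span {(X a * X b' : MvPolynomial (Fin 4) K)} := by
  classical
  set Q := shear j b (homogeneousComponent (d - 1) S) with hQ
  have hmain := levelTwo_shear_cone_thirdLetter hja hjb b hU hS hrel hord'
  -- `P` := the part of `Q` of `x_j`-degree ≤ 1
  refine ⟨∑ e ∈ Q.support with e j ≤ 1, monomial e (coeff e Q), ?_, ?_, ?_⟩
  · intro e he
    obtain ⟨e', he', hee'⟩ := Finset.mem_biUnion.mp (MvPolynomial.support_sum he)
    rw [Finset.mem_filter] at he'
    have h := support_monomial_subset hee'
    rw [Finset.mem_singleton] at h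
    rw [h]
    exact he'.2
  · refine MvPolynomial.IsHomogeneous.sum _ _ _ fun e he => ?_
    rw [Finset.mem_filter] at he
    have hhom := isHomogeneous_shear j b (homogeneousComponent_isHomogeneous (d - 1) S)
      (MvPolynomial.mem_support_iff.mp he.1)
    rw [weight_one_eq_degree] at hhom
    exact isHomogeneous_monomial _ hhom
  · rw [mem_span_X_mul_X_iff]
    intro e he
    have hce : coeff e (Q - ∑ e ∈ Q.support with e j ≤ 1, monomial e (coeff e Q)) ≠ 0 :=
      MvPolynomial.mem_support_iff.mp he
    rw [coeff_sub, coeff_sum] at hce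
    simp only [coeff_monomial] at hce
    rw [Finset.sum_ite_eq' (Q.support.filter fun e => e j ≤ 1) e (fun x => coeff x Q)] at hce
    by_cases hmem : e ∈ Q.support.filter fun e => e j ≤ 1
    · rw [if_pos hmem, sub_self] at hce
      exact absurd rfl hce
    · rw [if_neg hmem, sub_zero] at hce
      have heQ : e ∈ Q.support := MvPolynomial.mem_support_iff.mpr hce
      have hej : 2 ≤ e j := by
        by_contra hlt
        exact hmem (Finset.mem_filter.mpr ⟨heQ, by omega⟩)
      exact hmain e heQ hej

end ResCone

end Summit.ResolutionOfSingularities.ResolutionOfSingularities.Theorems.PIDim4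

end
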